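import Summits.ValiantsHypothesis.ValiantsHypothesis.Theorems.BarrierLeverAnchoredDoorHitsLowerPairsXElimLeaf

/-!
# Support item `AnchoredDoorHitsLowerPairs` (stmt-ValiantsHypothesis-22510), line `anchored-peeling`:
# X-ELIMINATION CERTIFICATES — a worked kernel instance (unit test of the certificate format)

Helper file (`--supports stmt-ValiantsHypothesis-22510`; cell valiant-natproofs, rung V4, 𝒟-side door (c); prover seat val-np-p1 gen 26). Closes NO item.

The smallest nontrivial certificate, written out against the landed format `XElim.XCert` (p699080) with combinatorial leaves (`XElim.XCert.leaf_of_card`,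
p699873): rows `{∅, {0}}`, columns `{(∅, ∅), (∅, {0})}` (the pair `(Δ⁰, Δ⁰)`): one step at the variable `0` with the single block item `{0}` (exponent 1),
capturing the column `(∅, {0})` as `({({0}|{0})}, ∅)` onto the link row `∅`; TOP = `({∅}; {(∅, ∅)})` and BOT = `({∅}; {({({0}|{0})}, ∅)})` are leaves.
Hence `isXCertPair_point : XElim.IsXCertPair ![∅, {0}] ![∅, {0}]` and, through `XElim.symbolicDet_ne_zero_of_isXCertPair`, a profile-2 hit of this pair —
of no interest in itself (the base case covers it); the point is that every side condition of `XCert.step` (`hlab`, `htop` = `IsTop`, `hinj`, the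
`filter`/`image` index sets of TOP and BOT) is dischargeable on a concrete instance exactly as the certificate search lab/xcert2.py produces them.

WHAT THIS IS NOT: nothing new about any pair; nothing on crux stmt-ValiantsHypothesis-14610 or on `VP` versus `VNP`.
-/

set_option linter.dupNamespace false

namespace Summit.ValiantsHypothesis.ValiantsHypothesis.Theorems.BarrierLever.AnchoredPeeling

open Finset

noncomputable section

namespace XElim

namespace Example

/-- The rows: `∅` and `{0}` (variables in `Fin 1`). -/
def R : Finset (Finset (Fin 1)) := {∅, {0}}

/-- The columns: `(∅, ∅)` and `(∅, {0})`. -/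
def F : Finset (LCol 1) := {((∅ : Finset (Anchor 1)), (∅ : Finset (Fin 1))), ((∅ : Finset (Anchor 1)), ({0} : Finset (Fin 1)))}

/-- The single block item `{0}`. -/
def IB : Finset (Finset (Fin 1)) := {{0}}

/-- No label items. -/
def IL : Finset (Anchor 1) := ∅

/-- The capture map: everything is captured by the block `{0}`. -/
def cap : LCol 1 → LCol 1 := fun c => capB (0 : Fin 1) ({0} : Finset (Fin 1)) c

/-- The blocks of `{0}` are `{{0}}`. -/
theorem blocks_singleton_zero : blocks ({0} : Finset (Fin 1)) = {{0}} := by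
  ext B
  rw [mem_blocks, Finset.mem_singleton]
  constructor
  · rintro ⟨hB, hc⟩
    rcases hc with h2 | ⟨h1, _⟩
    · have := Finset.card_le_card hB; rw [Finset.card_singleton] at this; omega
    · exact Finset.eq_of_subset_of_card_le hB (by rw [Finset.card_singleton, h1])
  · rintro rfl
    exact ⟨subset_rfl, Or.inr ⟨Finset.card_singleton 0, by rw [Finset.card_singleton]; omega⟩⟩

/-- The blocks of `∅` are `∅`. -/
theorem blocks_empty : blocks (∅ : Finset (Fin 1)) = ∅ := by
  ext B
  rw [mem_blocks]
  simp only [Finset.notMem_empty, iff_false, not_and, Finset.subset_empty]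
  rintro rfl
  simp

/-- The column `(∅, ∅)` is untouched. -/
theorem untouched_empty : Untouched IB IL ((∅ : Finset (Anchor 1)), (∅ : Finset (Fin 1))) := by
  refine ⟨fun ℓ hℓ => absurd hℓ (Finset.notMem_empty ℓ), fun B hB => ?_⟩
  rw [show ((∅ : Finset (Anchor 1)), (∅ : Finset (Fin 1))).2 = ∅ from rfl, blocks_empty] at hB
  exact absurd hB (Finset.notMem_empty B)

/-- The column `(∅, {0})` is touched. -/
theorem not_untouched_zero : ¬ Untouched IB IL ((∅ : Finset (Anchor 1)), ({0} : Finset (Fin 1))) := by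
  intro hU
  have := hU.2 {0} (by rw [show ((∅ : Finset (Anchor 1)), ({0} : Finset (Fin 1))).2 = {0} from rfl, blocks_singleton_zero]; exact Finset.mem_singleton_self _)
  exact this (by rw [IB]; exact Finset.mem_singleton_self _)

/-- The top item of the column `(∅, {0})`: the block `{0}` with exponent `1`. -/
theorem isTop_zero : IsTop (0 : Fin 1) IB IL (fun _ => 1) (fun _ => 0) ((∅ : Finset (Anchor 1)), ({0} : Finset (Fin 1))) 1
    (cap ((∅ : Finset (Anchor 1)), ({0} : Finset (Fin 1)))) := by
  refine ⟨le_rfl, fun ℓ hℓ => absurd hℓ (Finset.notMem_empty ℓ), fun B _ _ => le_rfl, Or.inr ⟨?_, {0}, ?_, ?_, rfl, fun B hB _ _ => ?_, rfl⟩⟩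
  · rw [Finset.card_eq_zero, Finset.filter_eq_empty_iff]
    intro ℓ hℓ; exact absurd hℓ (Finset.notMem_empty ℓ)
  · rw [show ((∅ : Finset (Anchor 1)), ({0} : Finset (Fin 1))).2 = {0} from rfl, blocks_singleton_zero]; exact Finset.mem_singleton_self _
  · rw [IB]; exact Finset.mem_singleton_self _
  · rw [show ((∅ : Finset (Anchor 1)), ({0} : Finset (Fin 1))).2 = {0} from rfl, blocks_singleton_zero, Finset.mem_singleton] at hB
    exact hB

/-- **THE CERTIFICATE** of the pair (rows `{∅, {0}}`, columns `{(∅, ∅), (∅, {0})}`). -/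
theorem xcert_point : XCert R F := by
  classical
  refine XCert.step (0 : Fin 1) R F IB IL (fun _ => 1) (fun _ => 0) (fun _ => 1) cap ?_ ?_ ?_ ?_ ?_
  · -- no labels at all
    intro c hc ℓ hℓ
    rw [F, Finset.mem_insert, Finset.mem_singleton] at hc
    rcases hc with rfl | rfl <;> exact absurd hℓ (Finset.notMem_empty ℓ)
  · intro c hc hnot
    rw [F, Finset.mem_insert, Finset.mem_singleton] at hc
    rcases hc with rfl | rfl
    · exact absurd untouched_empty hnot
    · exact isTop_zero
  · intro c hc c' hc' hn hn' _
    rw [F, Finset.mem_insert, Finset.mem_singleton] at hc hc'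
    rcases hc with rfl | rfl
    · exact absurd untouched_empty hn
    · rcases hc' with rfl | rfl
      · exact absurd untouched_empty hn'
      · rfl
  · -- TOP = ({∅}; {(∅, ∅)})
    have hR : R.filter (fun U => (0 : Fin 1) ∉ U) = {∅} := by
      ext U
      rw [Finset.mem_filter, R, Finset.mem_insert, Finset.mem_singleton, Finset.mem_singleton]
      constructor
      · rintro ⟨hU | hU, h0⟩
        · exact hU
        · exact absurd (hU ▸ Finset.mem_singleton_self (0 : Fin 1)) h0
      · rintro rfl; exact ⟨Or.inl rfl, Finset.notMem_empty _⟩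
    have hF : F.filter (fun c => Untouched IB IL c) = {((∅ : Finset (Anchor 1)), (∅ : Finset (Fin 1)))} := by
      ext c
      rw [Finset.mem_filter, F, Finset.mem_insert, Finset.mem_singleton, Finset.mem_singleton]
      constructor
      · rintro ⟨hc | hc, hu⟩
        · exact hc
        · exact absurd (hc ▸ hu) not_untouched_zero
      · rintro rfl; exact ⟨Or.inl rfl, untouched_empty⟩
    rw [hR, hF]
    exact XCert.leaf_of_card ∅ ∅ ∅ (fun h => absurd h Finset.not_nonempty_empty) (fun _ _ => rfl)
  · -- BOT = ({∅}; {({({0}|{0})}, ∅)})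
    have hR : (R.filter (fun U => (0 : Fin 1) ∈ U)).image (fun U => U.erase 0) = {∅} := by
      ext U
      rw [Finset.mem_image, Finset.mem_singleton]
      constructor
      · rintro ⟨V, hV, rfl⟩
        rw [Finset.mem_filter, R, Finset.mem_insert, Finset.mem_singleton] at hV
        rcases hV with ⟨rfl | rfl, h0⟩
        · exact absurd h0 (Finset.notMem_empty _)
        · exact Finset.erase_singleton 0
      · rintro rfl
        refine ⟨{0}, Finset.mem_filter.mpr ⟨?_, Finset.mem_singleton_self _⟩, Finset.erase_singleton 0⟩
        rw [R]; exact Finset.mem_insert_of_mem (Finset.mem_singleton_self _)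
    have hF : (F.filter (fun c => ¬ Untouched IB IL c)).image cap =
        {(({(({0} : Finset (Fin 1)), ({0} : Finset (Fin 1)))} : Finset (Anchor 1)), (∅ : Finset (Fin 1)))} := by
      ext c
      rw [Finset.mem_image, Finset.mem_singleton]
      constructor
      · rintro ⟨c', hc', rfl⟩
        rw [Finset.mem_filter, F, Finset.mem_insert, Finset.mem_singleton] at hc'
        rcases hc' with ⟨rfl | rfl, hn⟩
        · exact absurd untouched_empty hn
        · rw [cap, capB]; simp
      · rintro rfl
        refine ⟨((∅ : Finset (Anchor 1)), ({0} : Finset (Fin 1))), Finset.mem_filter.mpr ⟨?_, not_untouched_zero⟩, ?_⟩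
        · rw [F]; exact Finset.mem_insert_of_mem (Finset.mem_singleton_self _)
        · rw [cap, capB]; simp
    rw [hR, hF]
    exact XCert.leaf_of_card ∅ ∅ _ (fun h => absurd h Finset.not_nonempty_empty)
      (fun _ hL => absurd hL (Finset.singleton_ne_empty _))

/-- **The pair `(Δ⁰, Δ⁰)` is an x-elimination certificate pair.** -/
theorem isXCertPair_point : IsXCertPair (![∅, {0}] : Fin 2 → Finset (Fin 1)) (![∅, {0}] : Fin 2 → Finset (Fin 1)) := by
  have hR : (Finset.univ.image (![∅, {0}] : Fin 2 → Finset (Fin 1))) = R := by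
    ext U; rw [R]; simp [Fin.exists_fin_two]
    exact ⟨fun h => h.elim (fun h => Or.inl h.symm) (fun h => Or.inr h.symm), fun h => h.elim (fun h => Or.inl h.symm) (fun h => Or.inr h.symm)⟩
  have hF : (Finset.univ.image (fun j => ((∅ : Finset (Anchor 1)), (![∅, {0}] : Fin 2 → Finset (Fin 1)) j))) = F := by
    ext c; rw [F]; simp [Fin.exists_fin_two]
    exact ⟨fun h => h.elim (fun h => Or.inl h.symm) (fun h => Or.inr h.symm), fun h => h.elim (fun h => Or.inl h.symm) (fun h => Or.inr h.symm)⟩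
  rw [IsXCertPair, hR, hF]
  exact xcert_point

/-- Hence (through the landed soundness theorem) a profile-2 hit of this pair. -/
theorem symbolicDet_two_ne_zero_point :
    symbolicDet 2 1 2 (![∅, {0}] : Fin 2 → Finset (Fin 1)) (![∅, {0}] : Fin 2 → Finset (Fin 1)) ≠ 0 := by
  have hinj : Function.Injective (![∅, {0}] : Fin 2 → Finset (Fin 1)) := by
    intro i j hij
    fin_cases i <;> fin_cases j <;> simp_all
  exact symbolicDet_ne_zero_of_isXCertPair le_rfl hinj hinj isXCertPair_point

end Example

end XElim

end

end Summit.ValiantsHypothesis.ValiantsHypothesis.Theorems.BarrierLever.AnchoredPeeling
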